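import Literature.AnabelianGeometry.AbsoluteAnabelian.MonoidKummerModelProofs
import Literature.AnabelianGeometry.AbsoluteAnabelian.MonoidKummerModelCompactProofs
import Mathlib.Algebra.Colimit.Module

/-!
# [AbsTopIII] Prop 3.2 (ii): the Kummer map `M_TM → lim→_J H¹(J, μ_Ẑ(M_TM))` as a MONOID HOMOMORPHISM into
# the GROUP-structured direct limit (bridge over the landed interface; abc-iut cell, cross-layer L4 ↔ L6)

S. Mochizuki, *Topics in absolute anabelian geometry III*, §3, Proposition 3.2 (ii) p. 71 (bib key
`MochizukiAbsTopIII2015`; locators = kurims manuscript pages, lit key `paper:url-5493eb38cbb7`): "the Kummer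
maps `M^H_TM → H¹(H, μ_Ẑ(M_TM))`, `M_TM → lim→_J H¹(J, μ_Ẑ(M_TM))`" obtained "by considering the action of
open subgroups `H ⊆ Π` on elements of `M_TM` that are roots of elements of `M^H_TM`".  Consumed verbatim by
[IUTchII] Example 1.8 (ii) and Proposition 3.1 (ii) p. 88 ("`Ψ_cns(M^Θ_*) := M_TM(M^Θ_*) ⊆ lim_J H¹(…)` …
naturally isomorphic to `O^▷_{F̄_v}`"), whose typed form (abc-iut-L6-t2 `TemperedThetaMonoids.ThetaEnvData`,
field `constants : Submonoid H` of an ambient commutative GROUP `H`) and whose proof companions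
(`TemperedThetaMonoidsProofs2.lean`, p411791 / p411800: `κ : O →* H` injective, `mrange κ = constants`)
need the direct limit AS A GROUP and the Kummer map AS A MONOID HOMOMORPHISM — GAP-LEDGER row G-w4d019-1,
construction half.

The landed interface (abc-iut-L4-t2, `MonoidKummerMaps.lean`) carries the direct limit only as the bare
quotient `ContCohomologyData.H1Lim` (a `Quot` of `Σ J, H¹(J, ·)` by eventual agreement, NO algebraic
structure) and the Kummer map only as a bare function `MonoidKummerTheory.kummerLim : M → H1Lim`.  THIS FILE
(no new named `Prop` facts; constructions + theorems over the landed interface and the landed MODEL):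

* `ContCohomologyData.H1LimGrp C` — `lim→_J H¹(J, ·)` over the open subgroups `J ⊆ Π` ordered by reverse
  inclusion, as an ADDITIVE COMMUTATIVE GROUP (Mathlib `AddCommGroup.DirectLimit`; the transition maps are
  the restrictions `res`, a directed system by `res_id` / `res_comp`; the index poset is directed by `⊓`),
  with `ofGrp J : H¹(J, ·) →+ H1LimGrp` and the computation rule `ofGrp_eq_ofGrp_iff` (two classes agree iff
  they agree after restriction to a common open subgroup);
* `ContCohomologyData.toGrp : C.H1Lim → C.H1LimGrp` — the comparison with the landed bare quotient, PROVED
  BIJECTIVE (`toGrp_injective`, `toGrp_surjective`): the interface's `H1Lim` IS the underlying set of the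
  group-structured direct limit;
* `MonoidKummerTheory.kummerHom T : M →* Multiplicative T.coh.H1LimGrp` — for ANY `T : MonoidKummerTheory
  (Π ↷ M)`, the Kummer map into the direct limit as a MONOID HOMOMORPHISM (multiplicativity from the
  interface fields `kummer_mul` at the common open stabiliser and `kummerLim_spec`; `kummerHom_one`),
  agreeing with `kummerLim` under `toGrp` (`toAdd_kummerHom`), and `kummerHom_injective_iff` (injective iff
  `kummerLim` is);
* MODEL ([AbsTopIII] Def. 3.1 (i), abc-iut-L4-t2 `MonoidKummerModel{,Proofs,CompactProofs}`): for an MLF `k`,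
  `K = k̄`, model data `ε_k : Π_k ↠ G_k`, the Kummer homomorphism
  `𝒪_k̄^▷ →* Multiplicative (lim→_J H¹(J, Λ(k̄ˣ)))` of the model `TM`-pair is INJECTIVE when `ε_k` is an open
  map (`ModelMLFGaloisData.kummerHom_injective`), unconditionally for compact `Π_k`
  (`…_of_compactSpace`), and `𝒪_k̄^▷ ≃*` its image submonoid (`exists_mulEquiv_mrange_kummerHom`) — the
  "monoid of constants naturally isomorphic to `O^▷`" of [IUTchII] Prop. 3.1 (ii) at the model, now inside
  a genuine group.

NOT in this file (the remaining, named part of G-w4d019-1): the `Π`-ACTION on `lim→_J H¹(J, ·)` by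
conjugation (the interface `ContCohomologyData` carries restriction maps only, no conjugation maps), hence
the equivariance clause of the Kummer map; and the change of coefficients along the cyclotomic rigidity
isomorphisms `μ_Ẑ(M_TM) ⥲ μ_Ẑ(G_v) ⥲ Π_μ(M^Θ_*)` ([IUTchII] Cor. 1.11 (a) / 2.9 / 2.8 (i); abc-iut-L6-t1).
HONEST FRAMING: OUR packaging of classical Kummer theory as used by a refereed paper; nothing here bears on
[IUTchIII] Cor. 3.12; typed ≠ proved.
-/

noncomputable section

namespace Literature.AnabelianGeometry.AbsoluteAnabelian

universe u

/-! ### The group-structured direct limit `lim→_J H¹(J, ·)` -/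

namespace ContCohomologyData

variable {P : Type u} [Group P] [TopologicalSpace P] (C : ContCohomologyData P)

/-- The index poset of the direct limit: open subgroups of `Π` with the REVERSE inclusion order (along
which the restriction maps go). [cite: MochizukiAbsTopIII2015, Proposition 3.2 (ii) p.71] -/
abbrev LimIdx (P : Type u) [Group P] [TopologicalSpace P] : Type u := (OpenSubgroup P)ᵒᵈ

/-- Equality of indices is decided classically (required by `AddCommGroup.DirectLimit`).
[cite: MochizukiAbsTopIII2015, Proposition 3.2 (ii) p.71] -/
noncomputable instance LimIdx.instDecidableEq : DecidableEq (LimIdx P) := Classical.decEq _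

/-- The open subgroup underlying an index. [cite: MochizukiAbsTopIII2015, Proposition 3.2 (ii) p.71] -/
abbrev LimIdx.J (i : LimIdx P) : OpenSubgroup P := OrderDual.ofDual i

/-- `i ≤ j` in the index poset means `J_j ⊆ J_i`. [cite: MochizukiAbsTopIII2015, Proposition 3.2 (ii) p.71] -/
theorem LimIdx.le_iff {i j : LimIdx P} : i ≤ j ↔ j.J ≤ i.J := Iff.rfl

/-- The members of the system: `J ↦ H¹(J, μ_Ẑ(M))`. [cite: MochizukiAbsTopIII2015, Proposition 3.2 (ii) p.71] -/
abbrev GH1 (i : LimIdx P) : Type u := C.H1 i.J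

/-- The transition maps: restriction `H¹(J_i, ·) → H¹(J_j, ·)` for `i ≤ j` (`J_j ⊆ J_i`).
[cite: MochizukiAbsTopIII2015, Proposition 3.2 (ii) p.71] -/
def fH1 (i j : LimIdx P) (h : i ≤ j) : C.GH1 i →+ C.GH1 j := C.res (LimIdx.le_iff.mp h)

/-- The system `(H¹(J, ·), res)` is directed-compatible (`res_id`, `res_comp` of the interface).
[cite: MochizukiAbsTopIII2015, Proposition 3.2 (ii) p.71] -/
instance directedSystem : DirectedSystem C.GH1 fun i j h => C.fH1 i j h where
  map_self i x := by
    change C.res (le_refl i.J) x = x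
    rw [C.res_id]
    rfl
  map_map {k j i} hij hjk x := by
    change C.res _ (C.res _ x) = C.res _ x
    rw [← AddMonoidHom.comp_apply, ← C.res_comp]

/-- **`lim→_J H¹(J, μ_Ẑ(M))` as an additive commutative GROUP** (Mathlib's direct limit of the directed system
of restriction maps over the open subgroups of `Π`). [cite: MochizukiAbsTopIII2015, Proposition 3.2 (ii) p.71] -/
def H1LimGrp : Type u := AddCommGroup.DirectLimit C.GH1 C.fH1

/-- The group structure of `H1LimGrp`. [cite: MochizukiAbsTopIII2015, Proposition 3.2 (ii) p.71] -/
instance H1LimGrp.instAddCommGroup : AddCommGroup C.H1LimGrp :=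
  inferInstanceAs (AddCommGroup (AddCommGroup.DirectLimit C.GH1 C.fH1))

/-- The canonical map `H¹(J, ·) → lim→_J H¹(J, ·)`. [cite: MochizukiAbsTopIII2015, Proposition 3.2 (ii) p.71] -/
def ofGrp (J : OpenSubgroup P) : C.H1 J →+ C.H1LimGrp :=
  AddCommGroup.DirectLimit.of C.GH1 C.fH1 (OrderDual.toDual J)

/-- Compatibility of `ofGrp` with restriction: `[res_{J ≤ H} x] = [x]`.
[cite: MochizukiAbsTopIII2015, Proposition 3.2 (ii) p.71] -/
theorem ofGrp_res {H J : OpenSubgroup P} (h : J ≤ H) (x : C.H1 H) : C.ofGrp J (C.res h x) = C.ofGrp H x :=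
  AddCommGroup.DirectLimit.of_f (G := C.GH1) (f := C.fH1) (i := OrderDual.toDual H)
    (j := OrderDual.toDual J) h x

/-- Two classes in the group-structured direct limit agree iff they agree after restriction to SOME common
open subgroup. [cite: MochizukiAbsTopIII2015, Proposition 3.2 (ii) p.71] -/
theorem ofGrp_eq_ofGrp_iff {H H' : OpenSubgroup P} (x : C.H1 H) (y : C.H1 H') :
    C.ofGrp H x = C.ofGrp H' y ↔
      ∃ (L : OpenSubgroup P) (h : L ≤ H) (h' : L ≤ H'), C.res h x = C.res h' y := by
  constructor
  · intro hxy
    -- move both to the common level `H ⊓ H'`, then use exactness of the direct limit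
    have h0 : C.ofGrp (H ⊓ H') (C.res inf_le_left x - C.res inf_le_right y) = 0 := by
      rw [map_sub, C.ofGrp_res, C.ofGrp_res, hxy, sub_self]
    obtain ⟨j, hij, hj⟩ :=
      AddCommGroup.DirectLimit.of.zero_exact (G := C.GH1) (f := C.fH1) _ _ h0
    have hjL : j.J ≤ H ⊓ H' := LimIdx.le_iff.mp hij
    have hj' : C.res hjL (C.res inf_le_left x) = C.res hjL (C.res inf_le_right y) := by
      rw [← sub_eq_zero, ← map_sub]
      exact hj
    have e1 := DFunLike.congr_fun (C.res_comp (inf_le_left : H ⊓ H' ≤ H) hjL) x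
    have e2 := DFunLike.congr_fun (C.res_comp (inf_le_right : H ⊓ H' ≤ H') hjL) y
    simp only [AddMonoidHom.coe_comp, Function.comp_apply] at e1 e2
    exact ⟨j.J, hjL.trans inf_le_left, hjL.trans inf_le_right, e1.trans (hj'.trans e2.symm)⟩
  · rintro ⟨L, h, h', e⟩
    rw [← C.ofGrp_res h, ← C.ofGrp_res h', e]

/-- **Comparison with the landed bare quotient**: `H1Lim → H1LimGrp`, `[(J, x)] ↦ [x]` (well defined: the
quotient relation is eventual agreement under restriction). [cite: MochizukiAbsTopIII2015, Proposition 3.2 (ii) p.71] -/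
def toGrp : C.H1Lim → C.H1LimGrp :=
  Quot.lift (fun a => C.ofGrp a.1 a.2) (by
    rintro a b ⟨L, ha, hb, h⟩
    rw [← C.ofGrp_res ha, ← C.ofGrp_res hb, h])

/-- `toGrp` on representatives. [cite: MochizukiAbsTopIII2015, Proposition 3.2 (ii) p.71] -/
@[simp] theorem toGrp_mk (J : OpenSubgroup P) (x : C.H1 J) :
    C.toGrp (Quot.mk _ ⟨J, x⟩) = C.ofGrp J x := rfl

/-- The comparison `H1Lim → H1LimGrp` is INJECTIVE. [cite: MochizukiAbsTopIII2015, Proposition 3.2 (ii) p.71] -/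
theorem toGrp_injective : Function.Injective C.toGrp := by
  rintro ⟨a⟩ ⟨b⟩ h
  obtain ⟨L, ha, hb, e⟩ := (C.ofGrp_eq_ofGrp_iff a.2 b.2).mp h
  exact Quot.sound ⟨L, ha, hb, e⟩

/-- The comparison `H1Lim → H1LimGrp` is SURJECTIVE (every element of a directed direct limit is the class
of a single member). [cite: MochizukiAbsTopIII2015, Proposition 3.2 (ii) p.71] -/
theorem toGrp_surjective : Function.Surjective C.toGrp := by
  intro z
  induction z using AddCommGroup.DirectLimit.induction_on with
  | ih i x => exact ⟨Quot.mk _ ⟨i.J, x⟩, rfl⟩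

/-- Hence the landed `H1Lim` is in canonical bijection with the group-structured direct limit.
[cite: MochizukiAbsTopIII2015, Proposition 3.2 (ii) p.71] -/
theorem toGrp_bijective : Function.Bijective C.toGrp := ⟨C.toGrp_injective, C.toGrp_surjective⟩

end ContCohomologyData

/-! ### The Kummer map into the direct limit as a monoid homomorphism -/

/-- The open stabiliser of `m ∈ M` in a `TCG/TLG/TM`-pair `(Π ↷ M)` (Def. 3.1 (i)/(ii): stabilisers of the
action are open). [cite: MochizukiAbsTopIII2015, Definition 3.1 (ii) p.67] -/
def GaloisMonoidPair.stabilizerOpen (Pm : GaloisMonoidPair.{u}) (m : Pm.M) : OpenSubgroup Pm.Pi :=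
  ⟨MulAction.stabilizer Pm.Pi m, Pm.isOpen_stabilizer m⟩

/-- Membership in the open stabiliser. [cite: MochizukiAbsTopIII2015, Definition 3.1 (ii) p.67] -/
theorem GaloisMonoidPair.mem_stabilizerOpen_iff (Pm : GaloisMonoidPair.{u}) (m : Pm.M) (g : Pm.Pi) :
    g ∈ Pm.stabilizerOpen m ↔ g • m = m :=
  MulAction.mem_stabilizer_iff

namespace MonoidKummerTheory

variable {Pm : GaloisMonoidPair.{u}} (T : MonoidKummerTheory Pm)

/-- The Kummer class of `m` in the GROUP-structured direct limit. [cite: MochizukiAbsTopIII2015, Proposition 3.2 (ii) p.71] -/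
def kummerGrp (m : Pm.M) : T.coh.H1LimGrp := T.coh.toGrp (T.kummerLim m)

/-- Computation at any open subgroup fixing `m`: `kummerGrp m = [κ_H(m)]`.
[cite: MochizukiAbsTopIII2015, Proposition 3.2 (ii) p.71] -/
theorem kummerGrp_eq_ofGrp (m : Pm.M) (H : OpenSubgroup Pm.Pi) (hm : ∀ h : H, (h : Pm.Pi) • m = m) :
    T.kummerGrp m = T.coh.ofGrp H (T.kummer H ⟨m, hm⟩) := by
  rw [kummerGrp, T.kummerLim_spec m H hm]
  rfl

/-- **Multiplicativity of the Kummer map into the direct limit** (from the level-wise `kummer_mul` at the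
common open stabiliser of `m`, `m'`). [cite: MochizukiAbsTopIII2015, Proposition 3.2 (ii) p.71] -/
theorem kummerGrp_mul (m m' : Pm.M) : T.kummerGrp (m * m') = T.kummerGrp m + T.kummerGrp m' := by
  let H : OpenSubgroup Pm.Pi := Pm.stabilizerOpen m ⊓ Pm.stabilizerOpen m'
  have hm : ∀ h : H, (h : Pm.Pi) • m = m := fun h =>
    (Pm.mem_stabilizerOpen_iff m h).mp ((inf_le_left : H ≤ Pm.stabilizerOpen m) h.2)
  have hm' : ∀ h : H, (h : Pm.Pi) • m' = m' := fun h =>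
    (Pm.mem_stabilizerOpen_iff m' h).mp ((inf_le_right : H ≤ Pm.stabilizerOpen m') h.2)
  have hmm' : ∀ h : H, (h : Pm.Pi) • (m * m') = m * m' := fun h => by rw [smul_mul', hm h, hm' h]
  rw [T.kummerGrp_eq_ofGrp (m * m') H hmm', T.kummerGrp_eq_ofGrp m H hm, T.kummerGrp_eq_ofGrp m' H hm',
    ← map_add, ← T.kummer_mul H ⟨m, hm⟩ ⟨m', hm'⟩]

/-- The Kummer class of `1` vanishes. [cite: MochizukiAbsTopIII2015, Proposition 3.2 (ii) p.71] -/
theorem kummerGrp_one : T.kummerGrp 1 = 0 := by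
  have h := T.kummerGrp_mul 1 1
  rw [one_mul] at h
  exact left_eq_add.mp h

/-- **[AbsTopIII] Prop 3.2 (ii), the Kummer map `M_TM → lim→_J H¹(J, μ_Ẑ(M_TM))` as a MONOID HOMOMORPHISM**
into (the multiplicative form of) the group-structured direct limit. [cite: MochizukiAbsTopIII2015, Proposition 3.2 (ii) p.71] -/
def kummerHom : Pm.M →* Multiplicative T.coh.H1LimGrp where
  toFun m := Multiplicative.ofAdd (T.kummerGrp m)
  map_one' := by rw [T.kummerGrp_one]; rfl
  map_mul' m m' := by rw [T.kummerGrp_mul, ofAdd_add]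

/-- `kummerHom` IS the interface's `kummerLim` read in the group-structured limit.
[cite: MochizukiAbsTopIII2015, Proposition 3.2 (ii) p.71] -/
theorem toAdd_kummerHom (m : Pm.M) :
    Multiplicative.toAdd (T.kummerHom m) = T.coh.toGrp (T.kummerLim m) := rfl

/-- `kummerHom` on an element fixed by an open `H`: the class of `κ_H(m)`.
[cite: MochizukiAbsTopIII2015, Proposition 3.2 (ii) p.71] -/
theorem kummerHom_eq_ofGrp (m : Pm.M) (H : OpenSubgroup Pm.Pi) (hm : ∀ h : H, (h : Pm.Pi) • m = m) :
    T.kummerHom m = Multiplicative.ofAdd (T.coh.ofGrp H (T.kummer H ⟨m, hm⟩)) :=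
  congrArg Multiplicative.ofAdd (T.kummerGrp_eq_ofGrp m H hm)

/-- The Kummer homomorphism is injective iff the interface's Kummer map `kummerLim` is.
[cite: MochizukiAbsTopIII2015, Proposition 3.2 (ii) p.71] -/
theorem kummerHom_injective_iff : Function.Injective T.kummerHom ↔ Function.Injective T.kummerLim := by
  constructor
  · intro h m m' e
    exact h (congrArg (fun z => Multiplicative.ofAdd (T.coh.toGrp z)) e)
  · intro h m m' e
    exact h (T.coh.toGrp_injective (Multiplicative.ofAdd.injective e))

/-- For an INJECTIVE Kummer map: `M ≃*` the image submonoid of `kummerHom` inside the group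
`Multiplicative (lim→_J H¹(J, ·))`, naturally (the isomorphism is `kummerHom` on elements) — the shape
"monoid of constants `:=` image of the Kummer map, naturally isomorphic to `M`" of [IUTchII] Prop. 3.1 (ii).
[cite: MochizukiAbsTopIII2015, Proposition 3.2 (ii) p.71] -/
theorem exists_mulEquiv_mrange_kummerHom (h : Function.Injective T.kummerLim) :
    ∃ e : Pm.M ≃* MonoidHom.mrange T.kummerHom,
      ∀ m, ((e m : MonoidHom.mrange T.kummerHom) : Multiplicative T.coh.H1LimGrp) = T.kummerHom m :=
  have hinj := (T.kummerHom_injective_iff).mpr h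
  ⟨MulEquiv.ofBijective T.kummerHom.mrangeRestrict
      ⟨fun _ _ e => hinj (congrArg Subtype.val e), T.kummerHom.mrangeRestrict_surjective⟩,
    fun _ => rfl⟩

end MonoidKummerTheory

/-! ### The model `TM`-pair `(Π_k ↷ 𝒪_k̄^▷)`: injectivity -/

namespace ModelMLFGaloisData

variable (C : MLFClosure.{0}) (D : ModelMLFGaloisData C.k C.K)

/-- **The Kummer homomorphism `𝒪_k̄^▷ →* Multiplicative (lim→_J H¹(J, Λ(k̄ˣ)))` of the model is injective**
when `ε_k : Π_k ↠ G_k` is an open map (abc-iut-L4-t2's `kummerLim_injective`, Kummer-faithfulness of MLF's).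
[cite: MochizukiAbsTopIII2015, Proposition 3.2 (ii) p.71] -/
theorem kummerHom_injective (hε : IsOpenMap D.aug) :
    Function.Injective (D.kummerTheory C).kummerHom :=
  (MonoidKummerTheory.kummerHom_injective_iff _).mpr (D.kummerLim_injective C hε)

/-- The same unconditionally for compact (e.g. profinite) `Π_k`.
[cite: MochizukiAbsTopIII2015, Proposition 3.2 (ii) p.71] -/
theorem kummerHom_injective_of_compactSpace [CompactSpace D.Pi] :
    Function.Injective (D.kummerTheory C).kummerHom :=
  D.kummerHom_injective C D.isOpenMap_aug_of_compactSpace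

/-- **[IUTchII] Prop 3.1 (ii) at the model, inside a genuine group**: the image submonoid of the Kummer
homomorphism — "`Ψ_cns := M_TM ⊆ lim_J H¹(…)`" — is naturally isomorphic to `𝒪_k̄^▷ = O^▷_{k̄}` (open
`ε_k`). [cite: MochizukiAbsTopIII2015, Proposition 3.2 (ii) p.71] -/
theorem exists_mulEquiv_nonzeroIntegers_mrange_kummerHom (hε : IsOpenMap D.aug) :
    ∃ e : D.tmPair.M ≃* MonoidHom.mrange (D.kummerTheory C).kummerHom,
      ∀ m, ((e m : MonoidHom.mrange (D.kummerTheory C).kummerHom) :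
        Multiplicative (D.kummerTheory C).coh.H1LimGrp) = (D.kummerTheory C).kummerHom m :=
  MonoidKummerTheory.exists_mulEquiv_mrange_kummerHom _ (D.kummerLim_injective C hε)

end ModelMLFGaloisData

end Literature.AnabelianGeometry.AbsoluteAnabelian

end
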